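import Summits.RiemannHypothesis.RiemannHypothesis.Theorems.TiltedLandingLaw421R3Lens1ToothDichotomy

/-! # TiltedLandingLaw421 — lens-1 «RestFactorLogDeriv» IMAGE v1: the five- and four-pole split of `φ = f⁽ʲ⁺¹⁾/f⁽ʲ⁾` under a rest factor (S1)

W-09 lens-1 (rh33346-lens-1 g10). WORD = director-rh g30 (CA1073)(2) («then the two first lemmas … as an IMAGE candidate if they close in-seat») +
(CA1083)(4) («FREEZE it as a small IMAGE … token 146»); IMAGE v1 = SKETCH v1 1b1c16471dd95e02 with this docblock (statements and proofs VERBATIM).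
ONE import = TREE #1275 `…Theorems.TiltedLandingLaw421R3Lens1ToothDichotomy` (`RestFactor4` :109; carries #1271's `RestFactor` :67). Namespace
`RhW08.Lens1ToothNestUmbrella` reopened. SUPPORT (K-only): no `sorry`, no law, 2 (K) theorems; COUNT unmoved; registry v14q′ untouched.

CONTENT = first lemma 2 of the (ii′) brief `lens-1/scratch/g10/M-TARGET-ii.md` da372f12 §2, step (S1) of its chain, in the chain's currency
`iteratedDeriv (j + 1) f z / iteratedDeriv j f z` (the arc-sign ladder's `φ`): off the zeros of `f⁽ʲ⁾`,
`φ(z) = (z − T)⁻¹ + (z − T̄)⁻¹ + (z − b)⁻¹ + (z − b̄)⁻¹ + (z − t)⁻¹ + H′(z)/H(z)` under `RestFactor f j T b t H` (`logDeriv_of_restFactor`), and the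
four-pole twin under `RestFactor4 f j T b H` (`logDeriv_of_restFactor4`, for (iii′)). Proofs: factor non-vanishing from `f⁽ʲ⁾ z ≠ 0` by
`mul_ne_zero_iff`, the `HasDerivAt` product chain, `iteratedDeriv_succ`, `field_simp`. ERRATUM-3 of the brief (recorded here for the prover): its
first lemma 1 `nl_of_two_crit` (door (S5)) is ALREADY the tree's `RhW08.Hurwitz.nlEventOf_of_two_crit'` (`…R3Hurwitz.lean` :135) — cite it,
never re-prove.

HONEST LABEL: two identities of calculus; nothing here bears on the truth of RH; RH is not proved; ⟨33346⟩/⟨33347⟩ OPEN; stubs 1′/2/2′/3 OPEN;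
(ii′)/(iii′) asserted by nothing; typed ≠ checked ≠ landed ≠ proved. -/

noncomputable section

open Complex Set
open scoped ComplexConjugate

namespace RhW08.Lens1ToothNestUmbrella

/-- (K) (S1) FIVE-POLE SPLIT: under `RestFactor f j T b t H`, off the zeros of `f⁽ʲ⁾`,
`f⁽ʲ⁺¹⁾/f⁽ʲ⁾ = (z − T)⁻¹ + (z − T̄)⁻¹ + (z − b)⁻¹ + (z − b̄)⁻¹ + (z − t)⁻¹ + H′/H`. -/
theorem logDeriv_of_restFactor {f H : ℂ → ℂ} {j : ℕ} {T b : ℂ} {t : ℝ} (hH : RestFactor f j T b t H) {z : ℂ}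
    (hz : iteratedDeriv j f z ≠ 0) :
    iteratedDeriv (j + 1) f z / iteratedDeriv j f z =
      (z - T)⁻¹ + (z - conj T)⁻¹ + (z - b)⁻¹ + (z - conj b)⁻¹ + (z - t)⁻¹ + deriv H z / H z := by
  obtain ⟨hHd, hfac⟩ := hH
  have hne : (z - T) * (z - conj T) * (z - b) * (z - conj b) * (z - t) * H z ≠ 0 := by rw [← hfac z]; exact hz
  obtain ⟨h5, hHz⟩ := mul_ne_zero_iff.mp hne
  obtain ⟨h4, ht⟩ := mul_ne_zero_iff.mp h5
  obtain ⟨h3, hcb⟩ := mul_ne_zero_iff.mp h4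
  obtain ⟨h2, hb⟩ := mul_ne_zero_iff.mp h3
  obtain ⟨hT, hcT⟩ := mul_ne_zero_iff.mp h2
  have hF : iteratedDeriv j f = fun w => (w - T) * (w - conj T) * (w - b) * (w - conj b) * (w - t) * H w := funext hfac
  have hd : HasDerivAt (iteratedDeriv j f)
      (((((1 * (z - conj T) + (z - T) * 1) * (z - b) + (z - T) * (z - conj T) * 1) * (z - conj b)
        + (z - T) * (z - conj T) * (z - b) * 1) * (z - t) + (z - T) * (z - conj T) * (z - b) * (z - conj b) * 1) * H z
        + (z - T) * (z - conj T) * (z - b) * (z - conj b) * (z - t) * deriv H z) z := by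
    rw [hF]
    exact ((((((hasDerivAt_id' z).sub_const T).mul ((hasDerivAt_id' z).sub_const (conj T))).mul
      ((hasDerivAt_id' z).sub_const b)).mul ((hasDerivAt_id' z).sub_const (conj b))).mul
      ((hasDerivAt_id' z).sub_const (t : ℂ))).mul (hHd z).hasDerivAt
  rw [iteratedDeriv_succ, hd.deriv, hfac z]
  field_simp

/-- (K) FOUR-POLE SPLIT (tooth-free twin, for (iii′)): under `RestFactor4 f j T b H`, off the zeros of `f⁽ʲ⁾`,
`f⁽ʲ⁺¹⁾/f⁽ʲ⁾ = (z − T)⁻¹ + (z − T̄)⁻¹ + (z − b)⁻¹ + (z − b̄)⁻¹ + H′/H`. -/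
theorem logDeriv_of_restFactor4 {f H : ℂ → ℂ} {j : ℕ} {T b : ℂ} (hH : RestFactor4 f j T b H) {z : ℂ}
    (hz : iteratedDeriv j f z ≠ 0) :
    iteratedDeriv (j + 1) f z / iteratedDeriv j f z =
      (z - T)⁻¹ + (z - conj T)⁻¹ + (z - b)⁻¹ + (z - conj b)⁻¹ + deriv H z / H z := by
  obtain ⟨hHd, hfac⟩ := hH
  have hne : (z - T) * (z - conj T) * (z - b) * (z - conj b) * H z ≠ 0 := by rw [← hfac z]; exact hz
  obtain ⟨h4, hHz⟩ := mul_ne_zero_iff.mp hne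
  obtain ⟨h3, hcb⟩ := mul_ne_zero_iff.mp h4
  obtain ⟨h2, hb⟩ := mul_ne_zero_iff.mp h3
  obtain ⟨hT, hcT⟩ := mul_ne_zero_iff.mp h2
  have hF : iteratedDeriv j f = fun w => (w - T) * (w - conj T) * (w - b) * (w - conj b) * H w := funext hfac
  have hd : HasDerivAt (iteratedDeriv j f)
      ((((1 * (z - conj T) + (z - T) * 1) * (z - b) + (z - T) * (z - conj T) * 1) * (z - conj b)
        + (z - T) * (z - conj T) * (z - b) * 1) * H z + (z - T) * (z - conj T) * (z - b) * (z - conj b) * deriv H z) z := by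
    rw [hF]
    exact (((((hasDerivAt_id' z).sub_const T).mul ((hasDerivAt_id' z).sub_const (conj T))).mul
      ((hasDerivAt_id' z).sub_const b)).mul ((hasDerivAt_id' z).sub_const (conj b))).mul (hHd z).hasDerivAt
  rw [iteratedDeriv_succ, hd.deriv, hfac z]
  field_simp

end RhW08.Lens1ToothNestUmbrella
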